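import Summits.MatrixMultiplication.OmegaCensus.STPPVosperSlackOneLawMult

/-!
# ω-census (abelian STPP census): two-run structure (`|X ∪ (d + X)| = |X| + 2`) and the case-α₂ window table (kernel)

HONEST FRAMING (pub-omega census; verbatim): lottery ticket; floor = certified bounds/negative ranges.
Census STRUCTURE (seat pub-omega-stpp-1 gen 30, 2026-08-28), family (b2).  Tools for the slack-1 Vosper law at a block with `a = |Aᵢ| = 2`, where the
Hamidoune–Rødseth theorem (which needs `|S| ≥ 3`) is replaced on the `Aᵢ`-side by the ELEMENTARY two-run structure: if `Sn = −Aᵢ = {σ, σ + s}` and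
`|Sn + Y°| = |Y°| + 2`, then `Y°` is the union of two `s`-progressions, so `Sn + Y°` is the union of two `s`-progressions with one more term each.
Nothing here is progress on `ω`.

## Contents

* `two_runs_of_card_union_vadd` — `d ≠ 0`, `|X ∪ (d +ᵥ X)| = |X| + 2` in `ℤ/pℤ` ⇒ `X = {c₁ + i d : i < ℓ₁} ∪ {c₂ + i d : i < ℓ₂}` with `ℓ₁, ℓ₂ ≥ 1`,
  `ℓ₁ + ℓ₂ = |X|` (the two-endpoint version of `Vosper.isAP_of_card_union_vadd`: every element walks forward by `d` to the NEARER of the two endpoints).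
* `pair_add_eq_union_vadd`, `card_pair_add` — `{σ, σ+s} + Y = σ +ᵥ (Y ∪ (s +ᵥ Y))`.
* `prefixOK r PS` (`Bool`) and the case-α₂ table checker `tableAlpha2 p n₁ L r J` with its meaning `tableAlpha2_spec`; the generic window wrapper
  `prefix_nat_of_prefix_val` (prefix law on a set of residues ⇒ prefix law on the set of its values).

References: A. G. Vosper, J. London Math. Soc. 31 (1956); M. B. Nathanson, GTM 165, §2.5 (Lemma 2.4); Y. O. Hamidoune, Ø. J. Rødseth, Acta Arith. 92
(2000) (double progressions).
-/

open Finset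
open scoped Pointwise

namespace Summit.MatrixMultiplication.OmegaCensus.CubeNB

open Literature.Combinatorics.Additive

/-! ## §1 Two runs -/

section TwoRuns

variable {p : ℕ} [hp : Fact p.Prime]

/-- Steps to a target: `b + ((e − b)·d⁻¹).val • d = e`. [folklore] -/
theorem add_steps_eq (b e : ZMod p) {d : ZMod p} (hd : d ≠ 0) : b + ((e - b) * d⁻¹).val • d = e := by
  rw [nsmul_eq_mul, ZMod.natCast_zmod_val, mul_assoc, inv_mul_cancel₀ hd, mul_one]
  abel

/-- Steps to a target decrease by `i` after `i` steps (no wrap when `i ≤` the step count). [folklore] -/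
theorem steps_sub (b e : ZMod p) {d : ZMod p} (hd : d ≠ 0) {i : ℕ} (hi : i ≤ ((e - b) * d⁻¹).val) :
    ((e - (b + i • d)) * d⁻¹).val = ((e - b) * d⁻¹).val - i := by
  have hip : i < p := lt_of_le_of_lt hi (ZMod.val_lt _)
  have hiv : ((i : ℕ) : ZMod p).val = i := by rw [ZMod.val_natCast, Nat.mod_eq_of_lt hip]
  have heq : (e - (b + i • d)) * d⁻¹ = (e - b) * d⁻¹ - (i : ZMod p) := by
    rw [nsmul_eq_mul]
    have h1 : (i : ZMod p) * d * d⁻¹ = i := by rw [mul_assoc, mul_inv_cancel₀ hd, mul_one]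
    linear_combination (-1 : ZMod p) * h1
  rw [heq, ZMod.val_sub (by rw [hiv]; exact hi), hiv]

/-- **Two runs.**  In `ℤ/pℤ`, if `d ≠ 0` and `|X ∪ (d + X)| = |X| + 2`, then `X` is the union of two arithmetic progressions of common
difference `d` with `ℓ₁, ℓ₂ ≥ 1` terms, `ℓ₁ + ℓ₂ = |X|`, `ℓ₁ ≤ ℓ₂`. [cite: Nathanson1996, §2.5 Lemma 2.4 (proof idea)] -/
theorem two_runs_of_card_union_vadd {X : Finset (ZMod p)} {d : ZMod p} (hd : d ≠ 0)
    (h : (X ∪ (d +ᵥ X)).card = X.card + 2) :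
    ∃ c₁ c₂ : ZMod p, ∃ ℓ₁ ℓ₂ : ℕ, 1 ≤ ℓ₁ ∧ ℓ₁ ≤ ℓ₂ ∧ ℓ₁ + ℓ₂ = X.card ∧ X = apFinset c₁ d ℓ₁ ∪ apFinset c₂ d ℓ₂ := by
  -- the two new elements `d + e₁`, `d + e₂`
  have hT : ((d +ᵥ X) \ X).card = 2 := by
    have := card_sdiff_add_card (d +ᵥ X) X
    rw [union_comm] at this
    omega
  obtain ⟨u₁, u₂, hne, hT₀⟩ := card_eq_two.1 hT
  have hu₁ : u₁ ∈ (d +ᵥ X) \ X := by rw [hT₀]; simp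
  have hu₂ : u₂ ∈ (d +ᵥ X) \ X := by rw [hT₀]; simp
  rw [mem_sdiff, mem_vadd_finset] at hu₁ hu₂
  obtain ⟨⟨e₁, he₁, rfl⟩, he₁X⟩ := hu₁
  obtain ⟨⟨e₂, he₂, rfl⟩, he₂X⟩ := hu₂
  simp only [vadd_eq_add] at he₁X he₂X hne hT₀
  have hee : e₁ ≠ e₂ := fun h => hne (by rw [h])
  -- every other element has its successor in X
  have hE : ∀ b ∈ X, b ≠ e₁ → b ≠ e₂ → b + d ∈ X := by
    intro b hb h1 h2
    by_contra hbd
    have hmem : d + b ∈ (d +ᵥ X) \ X := by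
      rw [mem_sdiff]
      exact ⟨(add_mem_vadd_finset_iff d).2 hb, by rwa [add_comm] at hbd⟩
    rw [hT₀, mem_insert, mem_singleton] at hmem
    rcases hmem with hm | hm
    · exact h1 (add_left_cancel hm)
    · exact h2 (add_left_cancel hm)
  -- step counts to the two endpoints (kept opaque)
  obtain ⟨n₁, hn₁def⟩ : ∃ f : ZMod p → ℕ, ∀ b, f b = ((e₁ - b) * d⁻¹).val := ⟨_, fun _ => rfl⟩
  obtain ⟨n₂, hn₂def⟩ : ∃ f : ZMod p → ℕ, ∀ b, f b = ((e₂ - b) * d⁻¹).val := ⟨_, fun _ => rfl⟩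
  have hn₁ : ∀ b, b + n₁ b • d = e₁ := fun b => by rw [hn₁def]; exact add_steps_eq b e₁ hd
  have hn₂ : ∀ b, b + n₂ b • d = e₂ := fun b => by rw [hn₂def]; exact add_steps_eq b e₂ hd
  have hn₁lt : ∀ b, n₁ b < p := fun b => by rw [hn₁def]; exact ZMod.val_lt _
  have hn₂lt : ∀ b, n₂ b < p := fun b => by rw [hn₂def]; exact ZMod.val_lt _
  have hkey : ∀ b, n₁ b ≠ n₂ b := by
    intro b heq
    apply hee
    rw [← hn₁ b, ← hn₂ b, heq]
  have huniq₁ : ∀ b (j : ℕ), j < p → b + j • d = e₁ → j = n₁ b := fun b j hj h =>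
    zmod_natMul_injOn hd hj (hn₁lt b) (h.trans (hn₁ b).symm)
  have huniq₂ : ∀ b (j : ℕ), j < p → b + j • d = e₂ → j = n₂ b := fun b j hj h =>
    zmod_natMul_injOn hd hj (hn₂lt b) (h.trans (hn₂ b).symm)
  have hstep₁ : ∀ b (i : ℕ), i ≤ n₁ b → n₁ (b + i • d) = n₁ b - i := by
    intro b i hi
    rw [hn₁def, hn₁def]
    rw [hn₁def] at hi
    exact steps_sub b e₁ hd hi
  have hstep₂ : ∀ b (i : ℕ), i ≤ n₂ b → n₂ (b + i • d) = n₂ b - i := by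
    intro b i hi
    rw [hn₂def, hn₂def]
    rw [hn₂def] at hi
    exact steps_sub b e₂ hd hi
  -- walking forward up to the nearer endpoint stays in X
  have hC : ∀ b ∈ X, ∀ j, j ≤ n₁ b → j ≤ n₂ b → b + j • d ∈ X := by
    intro b hb j
    induction j with
    | zero => intros; simpa using hb
    | succ j ih =>
      intro hj1 hj2
      have hjX := ih (Nat.le_of_succ_le hj1) (Nat.le_of_succ_le hj2)
      have hb1 := hn₁lt b
      have hb2 := hn₂lt b
      have hne1 : b + j • d ≠ e₁ := fun heq => by have := huniq₁ b j (by omega) heq; omega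
      have hne2 : b + j • d ≠ e₂ := fun heq => by have := huniq₂ b j (by omega) heq; omega
      have := hE _ hjX hne1 hne2
      rwa [succ_nsmul, ← add_assoc]
  -- the two classes
  set X₁ := X.filter (fun b => n₁ b < n₂ b) with hX₁
  set X₂ := X.filter (fun b => n₂ b < n₁ b) with hX₂
  have hXU : X = X₁ ∪ X₂ := by
    ext b
    simp only [hX₁, hX₂, mem_union, mem_filter]
    constructor
    · intro hb
      rcases Nat.lt_or_gt_of_ne (hkey b) with hlt | hgt
      · exact Or.inl ⟨hb, hlt⟩
      · exact Or.inr ⟨hb, hgt⟩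
    · rintro (⟨hb, -⟩ | ⟨hb, -⟩) <;> exact hb
  have hXdisj : Disjoint X₁ X₂ := by
    rw [hX₁, hX₂, Finset.disjoint_filter]
    intro b _ h1 h2
    omega
  have he₁X₁ : e₁ ∈ X₁ := by
    rw [hX₁, mem_filter]
    refine ⟨he₁, ?_⟩
    have h0 : n₁ e₁ = 0 := by
      have := huniq₁ e₁ 0 hp.out.pos (by simp)
      exact this.symm
    have := hkey e₁
    omega
  have he₂X₂ : e₂ ∈ X₂ := by
    rw [hX₂, mem_filter]
    refine ⟨he₂, ?_⟩
    have h0 : n₂ e₂ = 0 := by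
      have := huniq₂ e₂ 0 hp.out.pos (by simp)
      exact this.symm
    have := hkey e₂
    omega
  -- class 1 is a progression ending at e₁
  obtain ⟨b₁, hb₁, hM₁⟩ := exists_mem_eq_sup X₁ ⟨e₁, he₁X₁⟩ n₁
  obtain ⟨b₂, hb₂, hM₂⟩ := exists_mem_eq_sup X₂ ⟨e₂, he₂X₂⟩ n₂
  have hb₁X : b₁ ∈ X := (mem_filter.1 hb₁).1
  have hb₂X : b₂ ∈ X := (mem_filter.1 hb₂).1
  have hb₁lt : n₁ b₁ < n₂ b₁ := (mem_filter.1 hb₁).2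
  have hb₂lt : n₂ b₂ < n₁ b₂ := (mem_filter.1 hb₂).2
  have hcl₁ : X₁ = apFinset b₁ d (X₁.sup n₁ + 1) := by
    ext x
    rw [mem_apFinset]
    constructor
    · intro hx
      have hxX : x ∈ X := (mem_filter.1 hx).1
      have hle : n₁ x ≤ X₁.sup n₁ := le_sup hx
      obtain ⟨j, hj⟩ : ∃ j, n₁ x + j = X₁.sup n₁ := ⟨X₁.sup n₁ - n₁ x, by omega⟩
      refine ⟨j, by omega, ?_⟩
      have e1 := hn₁ b₁
      have e2 := hn₁ x
      rw [← hM₁, ← hj, add_comm (n₁ x) j, add_nsmul] at e1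
      have e3 : (b₁ + j • d) + n₁ x • d = x + n₁ x • d := by rw [e2, ← e1]; abel
      exact add_right_cancel e3
    · rintro ⟨i, hi, rfl⟩
      have hi' : i ≤ n₁ b₁ := by rw [← hM₁]; omega
      rw [hX₁, mem_filter]
      refine ⟨hC b₁ hb₁X i hi' (by omega), ?_⟩
      rw [hstep₁ b₁ i hi', hstep₂ b₁ i (by omega)]
      omega
  have hcl₂ : X₂ = apFinset b₂ d (X₂.sup n₂ + 1) := by
    ext x
    rw [mem_apFinset]
    constructor
    · intro hx
      have hxX : x ∈ X := (mem_filter.1 hx).1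
      have hle : n₂ x ≤ X₂.sup n₂ := le_sup hx
      obtain ⟨j, hj⟩ : ∃ j, n₂ x + j = X₂.sup n₂ := ⟨X₂.sup n₂ - n₂ x, by omega⟩
      refine ⟨j, by omega, ?_⟩
      have e1 := hn₂ b₂
      have e2 := hn₂ x
      rw [← hM₂, ← hj, add_comm (n₂ x) j, add_nsmul] at e1
      have e3 : (b₂ + j • d) + n₂ x • d = x + n₂ x • d := by rw [e2, ← e1]; abel
      exact add_right_cancel e3
    · rintro ⟨i, hi, rfl⟩
      have hi' : i ≤ n₂ b₂ := by rw [← hM₂]; omega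
      rw [hX₂, mem_filter]
      refine ⟨hC b₂ hb₂X i (by omega) hi', ?_⟩
      rw [hstep₂ b₂ i hi', hstep₁ b₂ i (by omega)]
      omega
  have hc₁ : #X₁ = X₁.sup n₁ + 1 := by
    have h := congrArg Finset.card hcl₁
    rwa [card_apFinset hd (by have := hn₁lt b₁; rw [hM₁]; omega)] at h
  have hc₂ : #X₂ = X₂.sup n₂ + 1 := by
    have h := congrArg Finset.card hcl₂
    rwa [card_apFinset hd (by have := hn₂lt b₂; rw [hM₂]; omega)] at h
  have hsum : #X = #X₁ + #X₂ := by rw [hXU, card_union_of_disjoint hXdisj]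
  -- order the two runs by length
  have hcl₁' : apFinset b₁ d #X₁ = X₁ := by rw [hc₁]; exact hcl₁.symm
  have hcl₂' : apFinset b₂ d #X₂ = X₂ := by rw [hc₂]; exact hcl₂.symm
  rcases le_total #X₁ #X₂ with hle | hle
  · refine ⟨b₁, b₂, #X₁, #X₂, by omega, hle, hsum.symm, ?_⟩
    rw [hcl₁', hcl₂']; exact hXU
  · refine ⟨b₂, b₁, #X₂, #X₁, by omega, hle, by omega, ?_⟩
    rw [hcl₁', hcl₂', union_comm]; exact hXU

/-- A two-element set is a 2-term progression: `{σ, σ + s} = apFinset σ s 2`. [folklore] -/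
theorem pair_eq_apFinset (σ s : ZMod p) : ({σ, σ + s} : Finset (ZMod p)) = apFinset σ s 2 := by
  ext x
  rw [mem_insert, mem_singleton, mem_apFinset]
  constructor
  · rintro (rfl | rfl)
    · exact ⟨0, by omega, by simp⟩
    · exact ⟨1, by omega, by simp⟩
  · rintro ⟨i, hi, rfl⟩
    interval_cases i <;> simp

/-- `{σ, σ + s} + Y = σ +ᵥ (Y ∪ (s +ᵥ Y))`. [folklore] -/
theorem pair_add_eq_vadd_union (σ s : ZMod p) (Y : Finset (ZMod p)) :
    ({σ, σ + s} : Finset (ZMod p)) + Y = σ +ᵥ (Y ∪ (s +ᵥ Y)) := by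
  ext x
  simp only [Finset.mem_add, mem_insert, mem_singleton, mem_vadd_finset, mem_union, vadd_eq_add]
  constructor
  · rintro ⟨a, (rfl | rfl), y, hy, rfl⟩
    · exact ⟨y, Or.inl hy, rfl⟩
    · exact ⟨s + y, Or.inr ⟨y, hy, rfl⟩, by abel⟩
  · rintro ⟨z, (hz | ⟨y, hy, rfl⟩), rfl⟩
    · exact ⟨σ, Or.inl rfl, z, hz, rfl⟩
    · exact ⟨σ + s, Or.inr rfl, y, hy, by abel⟩

end TwoRuns

/-! ## §2 The case-α₂ table: two progressions in a window -/

section TableTwo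

/-- Prefix law on a finite set of naturals (`Bool`): every `x ∈ PS` has `r ∣ x − #{y ∈ PS : y < x}`. [folklore] -/
def prefixOK (r : ℕ) (PS : Finset ℕ) : Bool := decide (∀ x ∈ PS, r ∣ x - #(PS.filter fun y => y < x))

/-- **Case-α₂ table checker** (`Bool`).  For all `j < p` with `j ∉ J`, all `1 ≤ ℓ₁ < L` with `2ℓ₁ ≤ L`, all `t₁, t₂ < p` such that the progressions
`{t₁ + j i : i ≤ ℓ₁}` and `{t₂ + j i : i ≤ L − ℓ₁}` lie in `[0, n₁)`: the prefix law with run length `r` FAILS on their union. [folklore] -/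
def tableAlpha2 (p n₁ L r : ℕ) (J : Finset ℕ) : Bool :=
  (List.range p).all fun j => decide (j ∈ J) || (List.range L).all fun ℓ₁ => (ℓ₁ == 0) || !(decide (2 * ℓ₁ ≤ L)) ||
    (List.range p).all fun t₁ => !((List.range (ℓ₁ + 1)).all fun i => decide ((t₁ + j * i) % p < n₁)) ||
      (List.range p).all fun t₂ => !((List.range (L - ℓ₁ + 1)).all fun i => decide ((t₂ + j * i) % p < n₁)) ||
        !(prefixOK r ((range (ℓ₁ + 1)).image (fun i => (t₁ + j * i) % p) ∪ (range (L - ℓ₁ + 1)).image (fun i => (t₂ + j * i) % p)))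

/-- **Meaning of the case-α₂ checker.** [folklore] -/
theorem tableAlpha2_spec {p n₁ L r : ℕ} {J : Finset ℕ} (h : tableAlpha2 p n₁ L r J = true) :
    ∀ j < p, ∀ ℓ₁, 1 ≤ ℓ₁ → 2 * ℓ₁ ≤ L → ∀ t₁ < p, ∀ t₂ < p, (∀ i < ℓ₁ + 1, (t₁ + j * i) % p < n₁) → (∀ i < L - ℓ₁ + 1, (t₂ + j * i) % p < n₁) →
      prefixOK r ((range (ℓ₁ + 1)).image (fun i => (t₁ + j * i) % p) ∪ (range (L - ℓ₁ + 1)).image (fun i => (t₂ + j * i) % p)) = true →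
      j ∈ J := by
  intro j hj ℓ₁ hℓ1 hℓ2 t₁ ht₁ t₂ ht₂ hw1 hw2 hpre
  rw [tableAlpha2, List.all_eq_true] at h
  have h1 := h j (List.mem_range.2 hj)
  rw [Bool.or_eq_true, decide_eq_true_eq, List.all_eq_true] at h1
  rcases h1 with hJ | h1
  · exact hJ
  exfalso
  have h2 := h1 ℓ₁ (List.mem_range.2 (by omega))
  rw [Bool.or_eq_true, Bool.or_eq_true, List.all_eq_true] at h2
  rcases h2 with (h3 | h3) | h3
  · rw [beq_iff_eq] at h3; omega
  · rw [Bool.not_eq_true', decide_eq_false_iff_not] at h3; exact h3 hℓ2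
  have h4 := h3 t₁ (List.mem_range.2 ht₁)
  rw [Bool.or_eq_true, Bool.not_eq_true', List.all_eq_true] at h4
  rcases h4 with h5 | h5
  · rw [Bool.eq_false_iff] at h5
    apply h5
    rw [List.all_eq_true]
    intro i hi
    rw [decide_eq_true_eq]
    exact hw1 i (List.mem_range.1 hi)
  have h6 := h5 t₂ (List.mem_range.2 ht₂)
  rw [Bool.or_eq_true, Bool.not_eq_true', Bool.not_eq_true'] at h6
  rcases h6 with h7 | h7
  · rw [Bool.eq_false_iff] at h7
    apply h7
    rw [List.all_eq_true]
    intro i hi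
    rw [decide_eq_true_eq]
    exact hw2 i (List.mem_range.1 hi)
  · rw [hpre] at h7
    exact Bool.noConfusion h7

variable {p : ℕ} [hp : Fact p.Prime]

/-- **From residues to values.**  If every `x` of a finite `S ⊆ ℤ/pℤ` satisfies `r ∣ x.val − #{y ∈ S : y.val < x.val}`, then the set of values
`PS = val(S)` satisfies `prefixOK r PS`. [folklore] -/
theorem prefixOK_of_val {S : Finset (ZMod p)} {PS : Finset ℕ} (hPS : S.image ZMod.val = PS) {r : ℕ}
    (hgap : ∀ x ∈ S, r ∣ x.val - #(S.filter fun y => y.val < x.val)) : prefixOK r PS = true := by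
  rw [prefixOK, decide_eq_true_eq]
  intro x hx
  rw [← hPS, Finset.mem_image] at hx
  obtain ⟨y, hy, rfl⟩ := hx
  have hcount : #(PS.filter fun z => z < y.val) = #(S.filter fun z => z.val < y.val) := by
    rw [← hPS, Finset.filter_image, Finset.card_image_of_injective _ (ZMod.val_injective p)]
  rw [hcount]
  exact hgap y hy

/-- Values of a progression: `val({t + i•j : i < k}) = {(t.val + j.val·i) mod p : i < k}`. [folklore] -/
theorem image_val_apFinset (t j : ZMod p) (k : ℕ) :
    (apFinset t j k).image ZMod.val = (range k).image fun i => (t.val + j.val * i) % p := by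
  rw [apFinset, Finset.image_image]
  exact Finset.image_congr fun i _ => val_add_nsmul_zmod t j i

end TableTwo

end Summit.MatrixMultiplication.OmegaCensus.CubeNB
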